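import Mathlib
import Summits.Ventures.PercRepro2.Defs
import Summits.Ventures.PercRepro2.Independence
import Summits.Ventures.PercRepro2.Harris
import Summits.Ventures.PercRepro2.ThreeEventSafe
import Summits.Ventures.PercRepro2.ThreeEventCross
import Summits.Ventures.PercRepro2.ThreeEventCertificate
import Summits.Ventures.PercRepro2.ThreeEventCertificateSwap

/-!
# Symmetrised pointwise certificates (blind cell PercRepro2, p4 g33; proofs/P4-G33-CROSS.md §4c)

Both the defect and the cross term are unchanged when the two i.i.d. samples are swapped, so only the
SYMMETRISED pair weights matter: **`crossTerm_ge_of_pointwise_sym`** — if, on the configurations with `e`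
open, `λ₁ (c₁(ω,ω') + c₁(ω',ω)) + λ₂ (c₂(ω,ω') + c₂(ω',ω)) ≤ χ(ω,ω') + χ(ω',ω)` for the pair weights
`c₁, c₂` of two quadruples and the cross pair weight `χ`, then
`2 (λ₁ Ψ_{p[e↦1]}(1) + λ₂ Ψ_{p[e↦1]}(2)) ≤ 2 X_p(e)`. The instance `G = ↑{ac,bc,ad,bd}`,
`H = ↑{ab,ac,bd,cd}`, `B = ↓{ac,bd}` is certified at every edge by `c₁ = ` the pair weight of
`(G₀, ↑(G₀∩B₀), H₀, ↓(G₀∩B₀))` alone in this symmetrised sense, while no unsymmetrised certificate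
exists there (P4-G33-CROSS §4c). No definition, no instance, no notation.
-/

namespace Summit.Ventures.PercRepro2

namespace ThreeEvent

section Sym

variable {E : Type*} [Fintype E] [DecidableEq E] {R : Type*} [CommRing R]

/-- The cross term as a double sum with the samples swapped. -/
theorem crossTerm_eq_double_sum_swap (p : E → R) (e : E) (G H M B : Set (Config E)) :
    crossTerm p e G H M B
      = ∑ ω, ∑ ω', weight (Function.update p e 1) ω * weight (Function.update p e 1) ω'
          * (pairWt G H M B (Function.update ω' e false) ω
              + pairWt G H M B ω' (Function.update ω e false)) := by
  rw [crossTerm_eq_double_sum, Finset.sum_comm]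
  refine Finset.sum_congr rfl fun ω _ => Finset.sum_congr rfl fun ω' _ => ?_
  ring

/-- Twice the cross term as the double sum of the symmetrised cross pair weight. -/
theorem two_mul_crossTerm_eq (p : E → R) (e : E) (G H M B : Set (Config E)) :
    2 * crossTerm p e G H M B
      = ∑ ω, ∑ ω', weight (Function.update p e 1) ω * weight (Function.update p e 1) ω'
          * ((pairWt G H M B (Function.update ω e false) ω'
              + pairWt G H M B ω (Function.update ω' e false))
            + (pairWt G H M B (Function.update ω' e false) ω
              + pairWt G H M B ω' (Function.update ω e false))) := by
  rw [two_mul]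
  nth_rewrite 1 [crossTerm_eq_double_sum]
  rw [crossTerm_eq_double_sum_swap, ← Finset.sum_add_distrib]
  refine Finset.sum_congr rfl fun ω _ => ?_
  rw [← Finset.sum_add_distrib]
  refine Finset.sum_congr rfl fun ω' _ => ?_
  ring

/-- Twice the defect as the double sum of the symmetrised pair weight. -/
theorem two_mul_defect_eq (p : E → R) (G H M B : Set (Config E)) :
    2 * defect p G H M B
      = ∑ ω, ∑ ω', weight p ω * weight p ω' * (pairWt G H M B ω ω' + pairWt G H M B ω' ω) := by
  rw [two_mul]
  nth_rewrite 1 [defect_eq_double_sum]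
  rw [defect_eq_double_sum_swap, ← Finset.sum_add_distrib]
  refine Finset.sum_congr rfl fun ω _ => ?_
  rw [← Finset.sum_add_distrib]
  refine Finset.sum_congr rfl fun ω' _ => ?_
  ring

end Sym

section Certificate

variable {E : Type*} [Fintype E] [DecidableEq E] {R : Type*} [CommRing R] [LinearOrder R]
  [IsStrictOrderedRing R]

/-- **Symmetrised pointwise certificates.** If, on configurations with `e` open,
`λ₁ (c₁(ω,ω') + c₁(ω',ω)) + λ₂ (c₂(ω,ω') + c₂(ω',ω)) ≤ χ(ω,ω') + χ(ω',ω)`, then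
`2 (λ₁ Ψ_{p[e↦1]}(1) + λ₂ Ψ_{p[e↦1]}(2)) ≤ 2 X_p(e)`. -/
theorem crossTerm_ge_of_pointwise_sym {p : E → R} (hp : IsProbVec p) (e : E)
    (G H M B G₁ H₁ M₁ B₁ G₂ H₂ M₂ B₂ : Set (Config E)) (l₁ l₂ : R)
    (hcert : ∀ ω ω' : Config E, ω e = true → ω' e = true →
      l₁ * (pairWt G₁ H₁ M₁ B₁ ω ω' + pairWt G₁ H₁ M₁ B₁ ω' ω)
        + l₂ * (pairWt G₂ H₂ M₂ B₂ ω ω' + pairWt G₂ H₂ M₂ B₂ ω' ω)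
        ≤ (pairWt G H M B (Function.update ω e false) ω'
            + pairWt G H M B ω (Function.update ω' e false))
          + (pairWt G H M B (Function.update ω' e false) ω
            + pairWt G H M B ω' (Function.update ω e false))) :
    2 * (l₁ * defect (Function.update p e 1) G₁ H₁ M₁ B₁
      + l₂ * defect (Function.update p e 1) G₂ H₂ M₂ B₂) ≤ 2 * crossTerm p e G H M B := by
  rw [mul_add, mul_left_comm, mul_left_comm (2 : R), two_mul_defect_eq, two_mul_defect_eq,
    two_mul_crossTerm_eq]
  simp only [Finset.mul_sum]
  rw [← Finset.sum_add_distrib]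
  refine Finset.sum_le_sum fun ω _ => ?_
  rw [← Finset.sum_add_distrib]
  refine Finset.sum_le_sum fun ω' _ => ?_
  have hq : IsProbVec (Function.update p e 1) := hp.update e zero_le_one le_rfl
  have hw : 0 ≤ weight (Function.update p e 1) ω * weight (Function.update p e 1) ω' :=
    mul_nonneg (weight_nonneg hq ω) (weight_nonneg hq ω')
  by_cases h : ω e = true
  · by_cases h' : ω' e = true
    · have := mul_le_mul_of_nonneg_left (hcert ω ω' h h') hw
      linarith [this]
    · have h'' : ω' e = false := by simpa using h'
      rw [weight_update_one_eq_zero_of_false p h'']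
      simp
  · have h'' : ω e = false := by simpa using h
    rw [weight_update_one_eq_zero_of_false p h'']
    simp

end Certificate

end ThreeEvent

end Summit.Ventures.PercRepro2
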